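import Literature.Analysis.Calculus.ExpDuhamel
import Literature.MathematicalPhysics.QuantumFieldTheory.TiltedExponentMorseBounds
import Literature.MathematicalPhysics.QuantumFieldTheory.Balaban1983to89.T4AxialChain

/-!
# T4SegmentCurvature — the plaquette of a pure-potential configuration along the complexified interpolation segment
(cell `pub-balaban`, self-proposed kernel row T4-O3.E-i′-Oβ3a-SEG*, format obligation O-β3-a of the record
`t4/T4-XREAD-O3Ob3.md` v1.1 / GAPS G-pv12g6-1 (d); bookkeeping only)

HONEST FRAMING (cell `pub-balaban`, T4-DAG PAGE 1).  The cell's T4 target is the existence AND uniqueness of the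
continuum limit of Bałaban's unit-scale averaged loop expectations on a finite torus — a constructive-QFT statement
strictly beyond ultraviolet stability ([Balaban1989LargeFieldII] Thm 1 p. 355); it is NOT the Yang–Mills mass gap and
NOT the Clay problem.  This module is ELEMENTARY NORMED-ALGEBRA BOOKKEEPING behind one hypothesis of the sibling
`T4AxialChain.meanLipschitz_of_segment` (§5 there): that theorem bounds the variation of a conditional mean along the
REAL SEGMENT `s ↦ (b ↦ exp(iξ·s·A_u(b)))` between the flat representative `1` (`s = 0`, in the axial gauge of the
region) and the axial-gauge representative `exp(iξA_u)` of an exterior configuration `u` (`s = 1`) by Cauchy estimates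
on the closed discs of radius `α₁ / dev u` about `[0, 1]` (hypothesis `hseg`: the slice is analytic and bounded on a set
containing those discs).  The sibling's record left the
FORMAT OBLIGATION O-β3-a: "the real segment stays in the real small-field domain — needs a smallness CONDITION".  What
is typed here:
* §1 [folklore] FIRST-ORDER bounds for ordered, non-commutative products of exponentials in a Banach algebra:
  `‖∏ exp Xᵢ − 1‖ ≤ exp(Σ‖Xᵢ‖) − 1` and `‖∏ exp Xᵢ − 1 − Σ Xᵢ‖ ≤ exp(Σ‖Xᵢ‖) − 1 − Σ‖Xᵢ‖`
  (`norm_prod_exp_sub_one_le`, `norm_prod_exp_sub_one_sub_sum_le`; the zeroth-order chain bounds of `T4AxialChain`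
  §2–§3 are the siblings), from the one-factor bounds `‖exp a − 1‖ ≤ e^{‖a‖} − 1`
  (`Literature.Analysis.Calculus.norm_exp_sub_one_le`, module `ExpDuhamel`) and `‖exp a − 1 − a‖ ≤ e^{‖a‖} − 1 − ‖a‖`
  (`OneLinkLaplace.norm_exp_sub_one_sub_le`, module `TiltedExponentMorseBounds`), both REUSED by name.
* §2 [folklore] THE PLAQUETTE OF A PURE-POTENTIAL CONFIGURATION `V(b) = exp(c·A(b))` (`c` a real or complex scalar;
  intended `c = iξs` with `s` the complexified segment parameter): the plaquette variable `hol := exp(cA₁)·exp(cA₂)·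
  exp(−cA₃)·exp(−cA₄)` (written out, no definition) satisfies `‖hol − 1‖ ≤ ‖c‖·‖A₁ + A₂ − A₃ − A₄‖ +
  (e^{‖c‖S} − 1 − ‖c‖S)`, `S = Σ‖Aᵢ‖` (`norm_hol_sub_one_le`), `≤ ‖c‖·‖dA‖ + (‖c‖S)²` when `‖c‖S ≤ 1`
  (`norm_hol_sub_one_le_sq`).  The point of the first-order form: with `‖c‖ = ξσ`, `‖Aᵢ‖ ≤ a` and
  `‖A₁ + A₂ − A₃ − A₄‖ ≤ 2ξa′` one gets `‖hol − 1‖ ≤ ξ²·(2σa′ + 16σ²a²)` (`norm_hol_sub_one_le_xi_sq`) — the factor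
  `ξ²` of a curvature bound comes from the FIRST-ORDER CANCELLATION (the sum of the oriented potentials around the
  plaquette is `ξ` times a difference quotient), not from the smallness of `ξ‖A‖` alone, which gives only `O(ξ)`.
  Conversely the first-order term is recovered from the plaquette variable (`norm_smul_sum_le_of_hol`), so the whole
  segment is controlled FROM ITS ENDPOINT `c₁` (`norm_hol_sub_one_le_of_endpoint`): with `‖c₁‖ = ξ`, endpoint
  deviation `≤ δ₀ξ²` (the exterior's own small-field condition) and `‖Aᵢ‖ ≤ a`,
  `‖hol c − 1‖ ≤ ξ²·(σδ₀ + 16a²σ(1 + σ))` at `‖c‖ = ξσ` (`norm_hol_sub_one_le_of_curvature`) — first order in the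
  exterior's CURVATURE constant, the potential size entering only quadratically.
* §3 [bookkeeping] THE O-β3-a CONDITION (SUFFICIENT conditions, two packagings).  Every scalar `s` of the closed discs
  of radius `ϱ = α₁′/dev u` about `[0, 1]` has `|s| ≤ 1 + ϱ` (`norm_le_one_add_of_mem_closedBall`), so the excursion
  is `σ ≤ 1 + α₁′/dev u` and `σ·a ≤ dev u + α₁′` for potentials `a ≤ dev u`.  (Crude, potentials only:) if also the
  difference quotients are `≤ dev u`, the plaquette deviation over the whole family of discs is `≤ α₀·ξ²` PROVIDED
  `dev u + α₁′ ≤ α₀/4`, `α₀ ≤ 1/2` (`segment_condition`, `norm_hol_sub_one_le_of_condition`; thickening certified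
  `min(α₁, α₀/8)` for `dev u ≤ α₀/8`: `min_thickening_condition`, `meanLipschitz_of_segment_min`).  (Sharper, from the
  exterior's curvature constant `δ₀ ≤ κ·dev u`, `κ` = 1/(chain factor):) `≤ α₀·ξ²` PROVIDED
  `δ₀ + κα₁′ + 32(dev u + α₁′)² ≤ α₀ ≤ 1/2` (`segment_condition_of_curvature`, `norm_hol_sub_one_le_of_condition'`) —
  LINEAR in the curvature constant, QUADRATIC in the potential deviation (the shape "(100MR_j)²·α̃₀ ≲ 1" of the cell's
  record), met by the budget `δ₀ ≤ α₀/4`, `κα₁′ ≤ α₀/4`, `(dev u + α₁′)² ≤ α₀/64` (`curvature_budget`).  CONSTANTS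
  CONSEQUENCE recorded by the cell (bookkeeping about these sufficient conditions, not a theorem about Bałaban's
  objects): the complex thickening that may enter `lip = 4B/α₁′` of `meanLipschitz_of_segment` is the full `α₁′ = α₁`
  as soon as `α₁ ≤ min(α₀/(4κ), √α₀/8 − dev u)` — a cap by the real curvature domain that is void for small `κ` in its
  first member and mild in its second; nothing here shows that a larger thickening fails.
NOT DISCHARGED here, stated so that nobody reads more into the module: (a) the TOWER condition (iv) of
[Balaban1987RG1] p. 262 ((1.15)/(1.16), regularity of the averaged configurations at the levels below) along the
segment; (b) the G^c-gauge covariance of the conditional mean (obligation O-β3-b); (c) the identification of `a, a′,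
dev u` with norms of an actual axial-gauge potential, and every analytic input of `meanLipschitz_of_segment` — all
remain HYPOTHESES of the instantiating seat.  Value = kernel bookkeeping closing a located format obligation; NOT
summit progress; NO statement about Bałaban's renormalization-group objects is asserted.

MOTIVATING PRINTED LOCI (verbatim, journal page numbers; CONTEXT ONLY — nothing below is a formalisation of them).
* [Balaban1987RG1] (CMP 109) p. 262, the analyticity spaces: "(i) 𝐔 = U′U, U has values in the group G,
  |∂U − 1| < α₀ξ² on X, (1.11) for each cube □ ⊂ X of a size O(1)LM there exists a G-valued gauge transformation u
  defined on □ and such, that U^u = exp iξA, |A|, |∇^ξA| < O(1)LMBα₀ on □, (1.12)" … "(ii) U′ = exp iξA′, A′ has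
  values in the algebra 𝐠^c, |A′|, |∇^ξ_U A′| < α₁ on X. (1.13) (iii) The configurations 𝐔, 𝐉 satisfy the bounds
  |∂𝐔 − 1| < α₀ξ², |𝐉| < γ₀ on X. (1.14)".  Dictionary used in §2–§3 (the cell's, [bookkeeping]): a bond of the
  segment carries `exp(iξ·s·A(b))`, i.e. `c = iξs`, `‖c‖ = ξ|s|`; the oriented sum of the four potentials around a
  plaquette is `ξ` times a combination of two difference quotients `∇^ξA`, whence the hypothesis
  `‖A₁ + A₂ − A₃ − A₄‖ ≤ 2ξa′` with `a′` a bound on `|∇^ξA|`.  [cite: Balaban1987RG1, (1.11)–(1.14) p. 262]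
* [Balaban1985Averaging] (CMP 98) p. 26, why curvature is measured in units of the squared lattice spacing (`η²`
  there; [Balaban1987RG1] p. 262 (iv) writes "with j, ξ instead of k, η"): "Each averaging operation
  rescales a bound on plaquette variables approximately by the factor L², hence k operations by the factor L^{2k}. To
  get some small number yet, we have to assume that |U(∂p) − 1| < α₀η², η = L^{−k} (52)".
  [cite: Balaban1985Averaging, (52) p. 26]
Renders read (as images, this seat, for the two quotations above): CMP 109 p. 262 (PDF p. 14, ×2 and ×4), CMP 98
p. 26 (PDF p. 10, ×2 and ×4).

REVISION v1.1 (additive; every v1 declaration byte-identical, v1 = p181602): §2 gains the endpoint control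
`norm_smul_sum_le_of_hol`, `norm_hol_sub_one_le_of_endpoint`, `norm_hol_sub_one_le_of_curvature`; §3 gains the sharper
packaging `segment_condition_of_curvature`, `norm_hol_sub_one_le_of_condition'`, `curvature_budget`; header §2/§3
bullets rewritten accordingly (the v1 "min(α₁, α₀/8)" consequence is superseded by the milder cap stated above).
-/

noncomputable section

namespace Literature.MathematicalPhysics.QuantumFieldTheory.Balaban1983to89.T4SegmentCurvature

open NormedSpace Set Metric
open Literature.Analysis.Calculus (norm_exp_sub_one_le)
open Literature.MathematicalPhysics.QuantumFieldTheory.OneLinkLaplace (norm_exp_sub_one_sub_le)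

/-! ## §1  First-order bounds for products of exponentials [folklore] -/

section Exp

variable {𝔸 : Type*} [NormedRing 𝔸] [NormedAlgebra ℝ 𝔸] [CompleteSpace 𝔸]

/-- `u ↦ e^u − 1 − u` is monotone on `[0, ∞)`. [folklore] -/
theorem exp_sub_one_sub_mono {u t : ℝ} (hu : 0 ≤ u) (hut : u ≤ t) :
    Real.exp u - 1 - u ≤ Real.exp t - 1 - t := by
  have h1 : t - u + 1 ≤ Real.exp (t - u) := Real.add_one_le_exp (t - u)
  have h2 : 1 ≤ Real.exp u := Real.one_le_exp hu
  have h3 : Real.exp t = Real.exp u * Real.exp (t - u) := by rw [← Real.exp_add]; ring_nf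
  nlinarith [Real.exp_pos (t - u), mul_le_mul_of_nonneg_left h1 (Real.exp_pos u).le]

/-- ZEROTH ORDER: `‖∏ exp Xᵢ − 1‖ ≤ exp(Σ‖Xᵢ‖) − 1` for an ordered product in a (non-commutative) Banach algebra.
[folklore] -/
theorem norm_prod_exp_sub_one_le :
    ∀ l : List 𝔸, ‖(l.map exp).prod - 1‖ ≤ Real.exp (l.map (‖·‖)).sum - 1
  | [] => by simp
  | a :: l => by
      simp only [List.map_cons, List.prod_cons, List.sum_cons]
      have ha := norm_exp_sub_one_le a
      have ih := norm_prod_exp_sub_one_le l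
      set P := (l.map exp).prod
      set T := (l.map (‖·‖)).sum
      have hsplit : exp a * P - 1 = (exp a - 1) * (P - 1) + (exp a - 1) + (P - 1) := by noncomm_ring
      rw [hsplit]
      calc ‖(exp a - 1) * (P - 1) + (exp a - 1) + (P - 1)‖
          ≤ ‖exp a - 1‖ * ‖P - 1‖ + ‖exp a - 1‖ + ‖P - 1‖ :=
            (norm_add_le _ _).trans (add_le_add ((norm_add_le _ _).trans
              (add_le_add (norm_mul_le _ _) le_rfl)) le_rfl)
        _ ≤ (Real.exp ‖a‖ - 1) * (Real.exp T - 1) + (Real.exp ‖a‖ - 1) + (Real.exp T - 1) :=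
            add_le_add (add_le_add (mul_le_mul ha ih (norm_nonneg _) ((norm_nonneg _).trans ha)) ha) ih
        _ = Real.exp (‖a‖ + T) - 1 := by rw [Real.exp_add]; ring

/-- FIRST ORDER: `‖∏ exp Xᵢ − 1 − Σ Xᵢ‖ ≤ exp(Σ‖Xᵢ‖) − 1 − Σ‖Xᵢ‖` for an ordered product in a (non-commutative)
Banach algebra — the second-order remainder of the product is dominated by that of the scalar majorant. [folklore] -/
theorem norm_prod_exp_sub_one_sub_sum_le :
    ∀ l : List 𝔸, ‖(l.map exp).prod - 1 - l.sum‖ ≤ Real.exp (l.map (‖·‖)).sum - 1 - (l.map (‖·‖)).sum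
  | [] => by simp
  | a :: l => by
      simp only [List.map_cons, List.prod_cons, List.sum_cons]
      have ha := norm_exp_sub_one_le a
      have ha2 := norm_exp_sub_one_sub_le a
      have ih0 := norm_prod_exp_sub_one_le l
      have ih := norm_prod_exp_sub_one_sub_sum_le l
      set P := (l.map exp).prod
      set S := l.sum
      set T := (l.map (‖·‖)).sum
      have hsplit : exp a * P - 1 - (a + S) = (exp a - 1) * (P - 1) + (exp a - 1 - a) + (P - 1 - S) := by
        noncomm_ring
      rw [hsplit]
      calc ‖(exp a - 1) * (P - 1) + (exp a - 1 - a) + (P - 1 - S)‖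
          ≤ ‖exp a - 1‖ * ‖P - 1‖ + ‖exp a - 1 - a‖ + ‖P - 1 - S‖ :=
            (norm_add_le _ _).trans (add_le_add ((norm_add_le _ _).trans
              (add_le_add (norm_mul_le _ _) le_rfl)) le_rfl)
        _ ≤ (Real.exp ‖a‖ - 1) * (Real.exp T - 1) + (Real.exp ‖a‖ - 1 - ‖a‖) + (Real.exp T - 1 - T) :=
            add_le_add (add_le_add (mul_le_mul ha ih0 (norm_nonneg _) ((norm_nonneg _).trans ha)) ha2) ih
        _ = Real.exp (‖a‖ + T) - 1 - (‖a‖ + T) := by rw [Real.exp_add]; ring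

/-- Consequence: `‖∏ exp Xᵢ − 1‖ ≤ ‖Σ Xᵢ‖ + (exp(Σ‖Xᵢ‖) − 1 − Σ‖Xᵢ‖)` — first order in the SUM of the exponents,
second order in their sizes. [folklore] -/
theorem norm_prod_exp_sub_one_le_first_order (l : List 𝔸) :
    ‖(l.map exp).prod - 1‖ ≤ ‖l.sum‖ + (Real.exp (l.map (‖·‖)).sum - 1 - (l.map (‖·‖)).sum) := by
  have h := norm_prod_exp_sub_one_sub_sum_le l
  have hsplit : (l.map exp).prod - 1 = ((l.map exp).prod - 1 - l.sum) + l.sum := by abel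
  rw [hsplit]
  exact (norm_add_le _ _).trans (by linarith)

end Exp

/-! ## §2  The plaquette of a pure-potential configuration along the complexified segment [folklore] -/

section Plaquette

variable {𝕂 : Type*} [RCLike 𝕂] {𝔸 : Type*} [NormedRing 𝔸] [NormedAlgebra ℝ 𝔸] [NormedAlgebra 𝕂 𝔸]
  [CompleteSpace 𝔸]

/-! The plaquette variable ("holonomy") of the configuration `b ↦ exp(c·A(b))` is written out as the ordered product
over the four bonds of `∂p`, the last two traversed backwards (`exp(cA)⁻¹ = exp(−cA)`):
`exp(c•A₁)·exp(c•A₂)·exp(−(c•A₃))·exp(−(c•A₄))`; `c` is the scalar of the segment (intended `c = iξs`).  (No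
definition is introduced: consumers instantiate the product with their own bond variables.) -/

/-- THE FIRST-ORDER PLAQUETTE BOUND: `‖hol − 1‖ ≤ ‖c‖·‖A₁ + A₂ − A₃ − A₄‖ + (e^{‖c‖S} − 1 − ‖c‖S)`,
`S = ‖A₁‖ + ‖A₂‖ + ‖A₃‖ + ‖A₄‖`. [folklore] -/
theorem norm_hol_sub_one_le (c : 𝕂) (A₁ A₂ A₃ A₄ : 𝔸) :
    ‖exp (c • A₁) * exp (c • A₂) * exp (-(c • A₃)) * exp (-(c • A₄)) - 1‖ ≤ ‖c‖ * ‖A₁ + A₂ - A₃ - A₄‖ +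
      (Real.exp (‖c‖ * (‖A₁‖ + ‖A₂‖ + ‖A₃‖ + ‖A₄‖)) - 1 - ‖c‖ * (‖A₁‖ + ‖A₂‖ + ‖A₃‖ + ‖A₄‖)) := by
  have h := norm_prod_exp_sub_one_le_first_order (𝔸 := 𝔸) [c • A₁, c • A₂, -(c • A₃), -(c • A₄)]
  have hprod : (([c • A₁, c • A₂, -(c • A₃), -(c • A₄)] : List 𝔸).map exp).prod =
      exp (c • A₁) * exp (c • A₂) * exp (-(c • A₃)) * exp (-(c • A₄)) := by
    simp [mul_assoc]
  have hsum : ([c • A₁, c • A₂, -(c • A₃), -(c • A₄)] : List 𝔸).sum = c • (A₁ + A₂ - A₃ - A₄) := by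
    simp only [List.sum_cons, List.sum_nil, add_zero, smul_add, smul_sub]
    abel
  have hnorms : (([c • A₁, c • A₂, -(c • A₃), -(c • A₄)] : List 𝔸).map (‖·‖)).sum =
      ‖c‖ * (‖A₁‖ + ‖A₂‖ + ‖A₃‖ + ‖A₄‖) := by
    simp only [List.map_cons, List.map_nil, List.sum_cons, List.sum_nil, norm_neg, norm_smul]
    ring
  rw [hprod, hsum, hnorms, norm_smul] at h
  exact h

/-- Quadratic regime: for `‖c‖·S ≤ 1`, `‖hol − 1‖ ≤ ‖c‖·‖A₁ + A₂ − A₃ − A₄‖ + (‖c‖·S)²`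
(`Real.abs_exp_sub_one_sub_id_le`). [folklore] -/
theorem norm_hol_sub_one_le_sq (c : 𝕂) (A₁ A₂ A₃ A₄ : 𝔸)
    (hT : ‖c‖ * (‖A₁‖ + ‖A₂‖ + ‖A₃‖ + ‖A₄‖) ≤ 1) :
    ‖exp (c • A₁) * exp (c • A₂) * exp (-(c • A₃)) * exp (-(c • A₄)) - 1‖ ≤
      ‖c‖ * ‖A₁ + A₂ - A₃ - A₄‖ + (‖c‖ * (‖A₁‖ + ‖A₂‖ + ‖A₃‖ + ‖A₄‖)) ^ 2 := by
  set T := ‖c‖ * (‖A₁‖ + ‖A₂‖ + ‖A₃‖ + ‖A₄‖)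
  have hT0 : 0 ≤ T := by positivity
  have hq : Real.exp T - 1 - T ≤ T ^ 2 := by
    have h := Real.abs_exp_sub_one_sub_id_le (x := T) (by rwa [abs_of_nonneg hT0])
    exact (le_abs_self _).trans h
  exact (norm_hol_sub_one_le c A₁ A₂ A₃ A₄).trans (by linarith)

/-- IN CURVATURE UNITS [bookkeeping over the dictionary of the header]: `‖c‖ = ξσ` (`σ = |s|`), `‖Aᵢ‖ ≤ a`, the
oriented sum `‖A₁ + A₂ − A₃ − A₄‖ ≤ 2ξa′` (`ξ` times two difference quotients), and `4ξσa ≤ 1`; then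
`‖hol − 1‖ ≤ ξ²·(2σa′ + 16σ²a²)` — an `O(ξ²)` curvature bound along the segment. [folklore] -/
theorem norm_hol_sub_one_le_xi_sq (c : 𝕂) (A₁ A₂ A₃ A₄ : 𝔸) {ξ σ a a' : ℝ} (hξ : 0 ≤ ξ) (hσ : 0 ≤ σ)
    (hc : ‖c‖ = ξ * σ) (h₁ : ‖A₁‖ ≤ a) (h₂ : ‖A₂‖ ≤ a) (h₃ : ‖A₃‖ ≤ a) (h₄ : ‖A₄‖ ≤ a)
    (hdA : ‖A₁ + A₂ - A₃ - A₄‖ ≤ 2 * ξ * a') (hT : 4 * ξ * σ * a ≤ 1) :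
    ‖exp (c • A₁) * exp (c • A₂) * exp (-(c • A₃)) * exp (-(c • A₄)) - 1‖ ≤
      ξ ^ 2 * (2 * σ * a' + 16 * σ ^ 2 * a ^ 2) := by
  set S := ‖A₁‖ + ‖A₂‖ + ‖A₃‖ + ‖A₄‖
  have hS : S ≤ 4 * a := by simp only [S]; linarith
  have hS0 : 0 ≤ S := by positivity
  have hc0 : 0 ≤ ‖c‖ := norm_nonneg _
  have hTle : ‖c‖ * S ≤ 4 * ξ * σ * a := by
    rw [hc]; calc ξ * σ * S ≤ ξ * σ * (4 * a) := mul_le_mul_of_nonneg_left hS (mul_nonneg hξ hσ)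
      _ = 4 * ξ * σ * a := by ring
  have hq : Real.exp (‖c‖ * S) - 1 - ‖c‖ * S ≤ (4 * ξ * σ * a) ^ 2 := by
    have hmono := exp_sub_one_sub_mono (mul_nonneg hc0 hS0) hTle
    have h0 : 0 ≤ 4 * ξ * σ * a := (mul_nonneg hc0 hS0).trans hTle
    have h := Real.abs_exp_sub_one_sub_id_le (x := 4 * ξ * σ * a) (by rwa [abs_of_nonneg h0])
    exact hmono.trans ((le_abs_self _).trans h)
  have hlin : ‖c‖ * ‖A₁ + A₂ - A₃ - A₄‖ ≤ ξ * σ * (2 * ξ * a') := by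
    rw [hc]; exact mul_le_mul_of_nonneg_left hdA (mul_nonneg hξ hσ)
  calc ‖exp (c • A₁) * exp (c • A₂) * exp (-(c • A₃)) * exp (-(c • A₄)) - 1‖
        ≤ ‖c‖ * ‖A₁ + A₂ - A₃ - A₄‖ + (Real.exp (‖c‖ * S) - 1 - ‖c‖ * S) := norm_hol_sub_one_le c A₁ A₂ A₃ A₄
    _ ≤ ξ * σ * (2 * ξ * a') + (4 * ξ * σ * a) ^ 2 := add_le_add hlin hq
    _ = ξ ^ 2 * (2 * σ * a' + 16 * σ ^ 2 * a ^ 2) := by ring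

/-- DIFFERENCE QUOTIENTS FROM CURVATURE: the first-order term is recovered from the plaquette variable up to the
second-order remainder — `‖c•(A₁ + A₂ − A₃ − A₄)‖ ≤ ‖hol − 1‖ + (e^{‖c‖S} − 1 − ‖c‖S)`.  (Applied at the endpoint
`c₁ = iξ` this bounds `ξ‖dA_u(p)‖` by the exterior's own curvature plus `(4ξa)²`.) [folklore] -/
theorem norm_smul_sum_le_of_hol (c : 𝕂) (A₁ A₂ A₃ A₄ : 𝔸) :
    ‖c • (A₁ + A₂ - A₃ - A₄)‖ ≤ ‖exp (c • A₁) * exp (c • A₂) * exp (-(c • A₃)) * exp (-(c • A₄)) - 1‖ +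
      (Real.exp (‖c‖ * (‖A₁‖ + ‖A₂‖ + ‖A₃‖ + ‖A₄‖)) - 1 - ‖c‖ * (‖A₁‖ + ‖A₂‖ + ‖A₃‖ + ‖A₄‖)) := by
  have h := norm_prod_exp_sub_one_sub_sum_le (𝔸 := 𝔸) [c • A₁, c • A₂, -(c • A₃), -(c • A₄)]
  have hprod : (([c • A₁, c • A₂, -(c • A₃), -(c • A₄)] : List 𝔸).map exp).prod =
      exp (c • A₁) * exp (c • A₂) * exp (-(c • A₃)) * exp (-(c • A₄)) := by
    simp [mul_assoc]
  have hsum : ([c • A₁, c • A₂, -(c • A₃), -(c • A₄)] : List 𝔸).sum = c • (A₁ + A₂ - A₃ - A₄) := by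
    simp only [List.sum_cons, List.sum_nil, add_zero, smul_add, smul_sub]
    abel
  have hnorms : (([c • A₁, c • A₂, -(c • A₃), -(c • A₄)] : List 𝔸).map (‖·‖)).sum =
      ‖c‖ * (‖A₁‖ + ‖A₂‖ + ‖A₃‖ + ‖A₄‖) := by
    simp only [List.map_cons, List.map_nil, List.sum_cons, List.sum_nil, norm_neg, norm_smul]
    ring
  rw [hprod, hsum, hnorms] at h
  set P := exp (c • A₁) * exp (c • A₂) * exp (-(c • A₃)) * exp (-(c • A₄))
  have hsplit : c • (A₁ + A₂ - A₃ - A₄) = (P - 1) - (P - 1 - c • (A₁ + A₂ - A₃ - A₄)) := by abel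
  rw [hsplit]
  exact (norm_sub_le _ _).trans (by linarith)

/-- THE SEGMENT FROM ITS ENDPOINT: for scalars `c₁ ≠ 0` (the endpoint, intended `iξ`) and `c` (a point of the
complexified segment, intended `iξs`), `‖hol c − 1‖ ≤ (‖c‖/‖c₁‖)·(‖hol c₁ − 1‖ + R(‖c₁‖S)) + R(‖c‖S)` with
`R(t) = e^t − 1 − t` — the plaquette deviation along the segment is controlled by the endpoint's CURVATURE (not by its
potential) to first order, and by the potential only through second-order remainders. [folklore] -/
theorem norm_hol_sub_one_le_of_endpoint {c₁ : 𝕂} (hc₁ : c₁ ≠ 0) (c : 𝕂) (A₁ A₂ A₃ A₄ : 𝔸) :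
    ‖exp (c • A₁) * exp (c • A₂) * exp (-(c • A₃)) * exp (-(c • A₄)) - 1‖ ≤
      ‖c‖ / ‖c₁‖ * (‖exp (c₁ • A₁) * exp (c₁ • A₂) * exp (-(c₁ • A₃)) * exp (-(c₁ • A₄)) - 1‖ +
          (Real.exp (‖c₁‖ * (‖A₁‖ + ‖A₂‖ + ‖A₃‖ + ‖A₄‖)) - 1 - ‖c₁‖ * (‖A₁‖ + ‖A₂‖ + ‖A₃‖ + ‖A₄‖))) +
        (Real.exp (‖c‖ * (‖A₁‖ + ‖A₂‖ + ‖A₃‖ + ‖A₄‖)) - 1 - ‖c‖ * (‖A₁‖ + ‖A₂‖ + ‖A₃‖ + ‖A₄‖)) := by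
  have hc₁' : 0 < ‖c₁‖ := norm_pos_iff.mpr hc₁
  have h1 := norm_smul_sum_le_of_hol c₁ A₁ A₂ A₃ A₄
  have h2 := norm_hol_sub_one_le c A₁ A₂ A₃ A₄
  have hscale : ‖c‖ * ‖A₁ + A₂ - A₃ - A₄‖ = ‖c‖ / ‖c₁‖ * ‖c₁ • (A₁ + A₂ - A₃ - A₄)‖ := by
    rw [norm_smul]; field_simp
  rw [hscale] at h2
  have h3 : ‖c‖ / ‖c₁‖ * ‖c₁ • (A₁ + A₂ - A₃ - A₄)‖ ≤ ‖c‖ / ‖c₁‖ *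
      (‖exp (c₁ • A₁) * exp (c₁ • A₂) * exp (-(c₁ • A₃)) * exp (-(c₁ • A₄)) - 1‖ +
        (Real.exp (‖c₁‖ * (‖A₁‖ + ‖A₂‖ + ‖A₃‖ + ‖A₄‖)) - 1 - ‖c₁‖ * (‖A₁‖ + ‖A₂‖ + ‖A₃‖ + ‖A₄‖))) :=
    mul_le_mul_of_nonneg_left h1 (div_nonneg (norm_nonneg _) hc₁'.le)
  linarith

/-- IN CURVATURE UNITS, FROM THE EXTERIOR'S CURVATURE [bookkeeping over the dictionary of the header]: endpoint
`‖c₁‖ = ξ > 0` with plaquette deviation `≤ δ₀ξ²` (the exterior's own small-field condition) and potentials `‖Aᵢ‖ ≤ a`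
with `4ξa ≤ 1`; then at every point `‖c‖ = ξσ` of the complexified segment with `4ξσa ≤ 1`:
`‖hol c − 1‖ ≤ ξ²·(σδ₀ + 16a²σ(1 + σ))` — first order in the exterior's curvature constant, the potential size `a`
entering only quadratically. [folklore] -/
theorem norm_hol_sub_one_le_of_curvature {c₁ : 𝕂} (c : 𝕂) (A₁ A₂ A₃ A₄ : 𝔸) {ξ σ a δ₀ : ℝ} (hξ : 0 < ξ)
    (hσ : 0 ≤ σ) (hc₁ : ‖c₁‖ = ξ) (hc : ‖c‖ = ξ * σ) (h₁ : ‖A₁‖ ≤ a) (h₂ : ‖A₂‖ ≤ a) (h₃ : ‖A₃‖ ≤ a)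
    (h₄ : ‖A₄‖ ≤ a) (hcurv : ‖exp (c₁ • A₁) * exp (c₁ • A₂) * exp (-(c₁ • A₃)) * exp (-(c₁ • A₄)) - 1‖ ≤ δ₀ * ξ ^ 2)
    (ha1 : 4 * ξ * a ≤ 1) (hT : 4 * ξ * σ * a ≤ 1) :
    ‖exp (c • A₁) * exp (c • A₂) * exp (-(c • A₃)) * exp (-(c • A₄)) - 1‖ ≤
      ξ ^ 2 * (σ * δ₀ + 16 * a ^ 2 * σ * (1 + σ)) := by
  have hc₁0 : c₁ ≠ 0 := by
    intro h0; rw [h0, norm_zero] at hc₁; exact hξ.ne hc₁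
  set S := ‖A₁‖ + ‖A₂‖ + ‖A₃‖ + ‖A₄‖
  have hS : S ≤ 4 * a := by simp only [S]; linarith
  have hS0 : 0 ≤ S := by positivity
  have hR : ∀ {t u : ℝ}, 0 ≤ t → t ≤ u → u ≤ 1 → Real.exp t - 1 - t ≤ u ^ 2 := by
    intro t u ht htu hu1
    have hu0 : 0 ≤ u := ht.trans htu
    have h := Real.abs_exp_sub_one_sub_id_le (x := u) (by rwa [abs_of_nonneg hu0])
    exact (exp_sub_one_sub_mono ht htu).trans ((le_abs_self _).trans h)
  have hR₁ : Real.exp (‖c₁‖ * S) - 1 - ‖c₁‖ * S ≤ (4 * ξ * a) ^ 2 := by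
    refine hR (mul_nonneg (norm_nonneg _) hS0) ?_ ha1
    rw [hc₁]; calc ξ * S ≤ ξ * (4 * a) := mul_le_mul_of_nonneg_left hS hξ.le
      _ = 4 * ξ * a := by ring
  have hR₂ : Real.exp (‖c‖ * S) - 1 - ‖c‖ * S ≤ (4 * ξ * σ * a) ^ 2 := by
    refine hR (mul_nonneg (norm_nonneg _) hS0) ?_ hT
    rw [hc]; calc ξ * σ * S ≤ ξ * σ * (4 * a) := mul_le_mul_of_nonneg_left hS (mul_nonneg hξ.le hσ)
      _ = 4 * ξ * σ * a := by ring
  have hratio : ‖c‖ / ‖c₁‖ = σ := by rw [hc, hc₁]; field_simp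
  have h := norm_hol_sub_one_le_of_endpoint hc₁0 c A₁ A₂ A₃ A₄
  rw [hratio] at h
  calc ‖exp (c • A₁) * exp (c • A₂) * exp (-(c • A₃)) * exp (-(c • A₄)) - 1‖
      ≤ σ * (δ₀ * ξ ^ 2 + (4 * ξ * a) ^ 2) + (4 * ξ * σ * a) ^ 2 :=
        h.trans (add_le_add (mul_le_mul_of_nonneg_left (add_le_add hcurv hR₁) hσ) hR₂)
    _ = ξ ^ 2 * (σ * δ₀ + 16 * a ^ 2 * σ * (1 + σ)) := by ring

end Plaquette

/-! ## §3  The O-β3-a condition: the discs about `[0, 1]` stay inside the curvature domain [bookkeeping] -/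

section Condition

/-- A scalar in the closed `ϱ`-disc about a point of the real segment `[0, 1]` has size `≤ 1 + ϱ` — the real (and
complex) excursion forced by the hypothesis `hseg` of `T4AxialChain.meanLipschitz_of_segment`. [folklore] -/
theorem norm_le_one_add_of_mem_closedBall {s₀ : ℝ} (hs₀ : s₀ ∈ Icc (0 : ℝ) 1) {ϱ : ℝ} {s : ℂ}
    (hs : s ∈ closedBall (s₀ : ℂ) ϱ) : ‖s‖ ≤ 1 + ϱ := by
  rw [mem_closedBall, dist_eq_norm] at hs
  have h0 : ‖(s₀ : ℂ)‖ ≤ 1 := by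
    rw [Complex.norm_real, Real.norm_eq_abs, abs_of_nonneg hs₀.1]; exact hs₀.2
  calc ‖s‖ = ‖(s₀ : ℂ) + (s - s₀)‖ := by rw [add_sub_cancel]
    _ ≤ ‖(s₀ : ℂ)‖ + ‖s - (s₀ : ℂ)‖ := norm_add_le _ _
    _ ≤ 1 + ϱ := add_le_add h0 hs

/-- THE SMALLNESS CONDITION, typed.  If the axial potential and its difference quotients are bounded by the deviation,
`a, a′ ≤ dev`, the thickening used is `α₁′ ≥ 0`, and `dev + α₁′ ≤ α₀/4` with `α₀ ≤ 1/2`, then for every excursion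
`σ ≤ 1 + α₁′/dev` the curvature coefficient of §2 is `≤ α₀` and the quadratic-regime proviso holds:
`2σa′ + 16σ²a² ≤ α₀` and `4σa ≤ α₀ (≤ 1)`. [folklore] -/
theorem segment_condition {α₀ α₁' dev σ a a' : ℝ} (hα₀ : α₀ ≤ 1 / 2) (hdev : 0 < dev) (hα₁ : 0 ≤ α₁')
    (hsum : dev + α₁' ≤ α₀ / 4) (hσ0 : 0 ≤ σ) (hσ : σ ≤ 1 + α₁' / dev) (ha0 : 0 ≤ a) (ha : a ≤ dev)
    (ha'0 : 0 ≤ a') (ha' : a' ≤ dev) :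
    2 * σ * a' + 16 * σ ^ 2 * a ^ 2 ≤ α₀ ∧ 4 * σ * a ≤ α₀ := by
  have hx : ∀ {b : ℝ}, 0 ≤ b → b ≤ dev → σ * b ≤ dev + α₁' := by
    intro b hb0 hb
    have h1 : σ * b ≤ (1 + α₁' / dev) * b := mul_le_mul_of_nonneg_right hσ hb0
    have h2 : (1 + α₁' / dev) * b = b + α₁' * (b / dev) := by field_simp
    have h3 : b / dev ≤ 1 := (div_le_one hdev).mpr hb
    have h4 : α₁' * (b / dev) ≤ α₁' := mul_le_of_le_one_right hα₁ h3
    linarith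
  have hxa : σ * a ≤ α₀ / 4 := (hx ha0 ha).trans hsum
  have hxa' : σ * a' ≤ α₀ / 4 := (hx ha'0 ha').trans hsum
  have hσa0 : 0 ≤ σ * a := mul_nonneg hσ0 ha0
  have hα₀0 : 0 ≤ α₀ := by linarith [mul_nonneg hσ0 ha'0]
  refine ⟨?_, by linarith⟩
  have hsq : (σ * a) ^ 2 ≤ (α₀ / 4) ^ 2 := pow_le_pow_left₀ hσa0 hxa 2
  nlinarith

/-- THE PLAQUETTE DEVIATION OVER THE WHOLE FAMILY OF DISCS: under the condition of `segment_condition`, with `ξ ≤ 1`,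
every scalar `c` of size `‖c‖ = ξσ`, `σ ≤ 1 + α₁′/dev` (all points of the closed `α₁′/dev`-discs about `[0, 1]`, times
`iξ`) gives a pure-potential configuration whose plaquettes deviate from `1` by at most `α₀·ξ²` — the shape of the real
curvature condition (1.11) and of the complex one (1.14) in the header's dictionary. [folklore] -/
theorem norm_hol_sub_one_le_of_condition {𝕂 : Type*} [RCLike 𝕂] {𝔸 : Type*} [NormedRing 𝔸] [NormedAlgebra ℝ 𝔸]
    [NormedAlgebra 𝕂 𝔸] [CompleteSpace 𝔸] (c : 𝕂) (A₁ A₂ A₃ A₄ : 𝔸) {ξ σ a a' α₀ α₁' dev : ℝ}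
    (hξ0 : 0 ≤ ξ) (hξ1 : ξ ≤ 1) (hα₀ : α₀ ≤ 1 / 2) (hdev : 0 < dev) (hα₁ : 0 ≤ α₁') (hsum : dev + α₁' ≤ α₀ / 4)
    (hσ0 : 0 ≤ σ) (hσ : σ ≤ 1 + α₁' / dev) (hc : ‖c‖ = ξ * σ) (ha0 : 0 ≤ a) (ha : a ≤ dev) (ha'0 : 0 ≤ a')
    (ha' : a' ≤ dev) (h₁ : ‖A₁‖ ≤ a) (h₂ : ‖A₂‖ ≤ a) (h₃ : ‖A₃‖ ≤ a) (h₄ : ‖A₄‖ ≤ a)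
    (hdA : ‖A₁ + A₂ - A₃ - A₄‖ ≤ 2 * ξ * a') :
    ‖exp (c • A₁) * exp (c • A₂) * exp (-(c • A₃)) * exp (-(c • A₄)) - 1‖ ≤ α₀ * ξ ^ 2 := by
  obtain ⟨hcoef, h4⟩ := segment_condition hα₀ hdev hα₁ hsum hσ0 hσ ha0 ha ha'0 ha'
  have hT : 4 * ξ * σ * a ≤ 1 := by
    have : 4 * ξ * σ * a ≤ 4 * σ * a := by
      have h0 : 0 ≤ 4 * σ * a := by positivity
      nlinarith
    linarith
  calc ‖exp (c • A₁) * exp (c • A₂) * exp (-(c • A₃)) * exp (-(c • A₄)) - 1‖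
        ≤ ξ ^ 2 * (2 * σ * a' + 16 * σ ^ 2 * a ^ 2) :=
          norm_hol_sub_one_le_xi_sq c A₁ A₂ A₃ A₄ hξ0 hσ0 hc h₁ h₂ h₃ h₄ hdA hT
    _ ≤ ξ ^ 2 * α₀ := mul_le_mul_of_nonneg_left hcoef (sq_nonneg ξ)
    _ = α₀ * ξ ^ 2 := mul_comm _ _

/-- THE CONSTANTS CONSEQUENCE for `T4AxialChain.meanLipschitz_of_segment`: with the thickening
`α₁′ := min α₁ (α₀/8)` and deviations `dev ≤ α₀/8` the (sufficient) condition `dev + α₁′ ≤ α₀/4` of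
`segment_condition` holds, and `α₁′ ≤ α₁` (a thinner tube is still inside the analyticity tube) — so the Lipschitz
constant that the segment argument certifies under THIS condition is `4B/min(α₁, α₀/8)`, equal to the recorded `4B/α₁`
when `α₁ ≤ α₀/8` (nothing here shows that the full thickening `α₁` fails). [folklore] -/
theorem min_thickening_condition {α₀ α₁ dev : ℝ} (hdev : dev ≤ α₀ / 8) :
    dev + min α₁ (α₀ / 8) ≤ α₀ / 4 ∧ min α₁ (α₀ / 8) ≤ α₁ := by
  constructor
  · have h := min_le_right α₁ (α₀ / 8); linarith
  · exact min_le_left _ _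

/-- … and the sibling's hand-off instantiated with the thinner tube: the hypotheses of
`T4AxialChain.meanLipschitz_of_segment` stated for the thickening `min α₁ (α₀/8)` give
`MeanLipschitz dom m S u₀ dev (4B / min α₁ (α₀/8))`. [folklore] -/
theorem meanLipschitz_of_segment_min {𝒰 β F : Type*} [NormedAddCommGroup F] [NormedSpace ℂ F] [CompleteSpace F]
    {dom : Set 𝒰} {m : 𝒰 → β → F} {S : Finset β} {u₀ : 𝒰} {dev : 𝒰 → ℝ} {α₀ α₁ B : ℝ} (hα₁ : 0 < α₁)
    (hα₀ : 0 < α₀) (hdev : ∀ u ∈ dom, 0 ≤ dev u)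
    (hseg : ∀ u ∈ dom, 0 < dev u → ∀ b ∈ S, ∃ (g : ℂ → F) (D : Set ℂ), g 0 = m u₀ b ∧ g 1 = m u b ∧
      DifferentiableOn ℂ g D ∧ (∀ z ∈ D, ‖g z‖ ≤ B) ∧
        ∀ s ∈ Icc (0 : ℝ) 1, closedBall (s : ℂ) (min α₁ (α₀ / 8) / dev u) ⊆ D)
    (hflat : ∀ u ∈ dom, dev u = 0 → ∀ b ∈ S, m u b = m u₀ b) :
    T4FirstOrderSize.MeanLipschitz dom m S u₀ dev (4 * B / min α₁ (α₀ / 8)) :=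
  T4AxialChain.meanLipschitz_of_segment (lt_min hα₁ (by linarith)) hdev hseg hflat

/-! ### The sharper packaging: from the exterior's CURVATURE constant (v1.1)

In the form `norm_hol_sub_one_le_of_curvature` the potential size enters only quadratically, the first-order term
being the exterior's own curvature constant `δ₀` times the excursion `σ ≤ 1 + α₁′/dev`.  With `δ₀ ≤ κ·dev` (the
curvature constant is at most `κ` times the potential bound — for a chained axial potential `κ` = 1/(chain factor)
`≤ 1`) the sufficient condition becomes `δ₀ + κ·α₁′ + 32·(dev + α₁′)² ≤ α₀` (`α₀ ≤ 1/2`): LINEAR in `δ₀`, QUADRATIC in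
the potential size — the shape "(potential deviation)² ≲ α₀" of the cell's record (GAPS G-pv12g6-1 (d)). -/

/-- THE SHARPER SMALLNESS CONDITION, typed: `a ≤ dev`, `δ₀ ≤ κ·dev`, `σ ≤ 1 + α₁′/dev` and
`δ₀ + κα₁′ + 32(dev + α₁′)² ≤ α₀ ≤ 1/2` give `σδ₀ + 16a²σ(1 + σ) ≤ α₀` together with the provisos `4σa ≤ 1`,
`4a ≤ 1`. [folklore] -/
theorem segment_condition_of_curvature {α₀ α₁' dev σ a δ₀ κ : ℝ} (hα₀ : α₀ ≤ 1 / 2) (hdev : 0 < dev)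
    (hα₁ : 0 ≤ α₁') (hκ : 0 ≤ κ) (hδ₀0 : 0 ≤ δ₀) (hδ₀ : δ₀ ≤ κ * dev)
    (hsum : δ₀ + κ * α₁' + 32 * (dev + α₁') ^ 2 ≤ α₀) (hσ0 : 0 ≤ σ) (hσ : σ ≤ 1 + α₁' / dev) (ha0 : 0 ≤ a)
    (ha : a ≤ dev) :
    σ * δ₀ + 16 * a ^ 2 * σ * (1 + σ) ≤ α₀ ∧ 4 * σ * a ≤ 1 ∧ 4 * a ≤ 1 := by
  set x := dev + α₁'
  -- excursion times potential: σ·a ≤ a + α₁′·(a/dev) ≤ dev + α₁′ = x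
  have hσa : σ * a ≤ x := by
    have h1 : σ * a ≤ (1 + α₁' / dev) * a := mul_le_mul_of_nonneg_right hσ ha0
    have h2 : (1 + α₁' / dev) * a = a + α₁' * (a / dev) := by field_simp
    have h3 : a / dev ≤ 1 := (div_le_one hdev).mpr ha
    have h4 : α₁' * (a / dev) ≤ α₁' := mul_le_of_le_one_right hα₁ h3
    simp only [x]; linarith
  have hax : a ≤ x := by simp only [x]; linarith
  -- excursion times curvature: σ·δ₀ ≤ δ₀ + α₁′·(δ₀/dev) ≤ δ₀ + κ·α₁′
  have hσδ : σ * δ₀ ≤ δ₀ + κ * α₁' := by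
    have h1 : σ * δ₀ ≤ (1 + α₁' / dev) * δ₀ := mul_le_mul_of_nonneg_right hσ hδ₀0
    have h2 : (1 + α₁' / dev) * δ₀ = δ₀ + α₁' * (δ₀ / dev) := by field_simp
    have h3 : δ₀ / dev ≤ κ := (div_le_iff₀ hdev).mpr hδ₀
    have h4 : α₁' * (δ₀ / dev) ≤ α₁' * κ := mul_le_mul_of_nonneg_left h3 hα₁
    linarith
  have hx0 : 0 ≤ x := ha0.trans hax
  have hσa0 : 0 ≤ σ * a := mul_nonneg hσ0 ha0
  -- the quadratic terms: a²σ(1+σ) = a·(σa) + (σa)² ≤ x² + x²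
  have hq : a ^ 2 * σ * (1 + σ) ≤ 2 * x ^ 2 := by
    have e : a ^ 2 * σ * (1 + σ) = a * (σ * a) + (σ * a) ^ 2 := by ring
    rw [e]
    have h1 : a * (σ * a) ≤ x * x := mul_le_mul hax hσa hσa0 hx0
    have h2 : (σ * a) ^ 2 ≤ x ^ 2 := pow_le_pow_left₀ hσa0 hσa 2
    nlinarith
  have hx2 : 32 * x ^ 2 ≤ α₀ := by
    have : 0 ≤ δ₀ + κ * α₁' := add_nonneg hδ₀0 (mul_nonneg hκ hα₁)
    simp only [x]; linarith
  -- provisos: 32x² ≤ α₀ ≤ 1/2 ⇒ x ≤ 1/8 ⇒ 4σa, 4a ≤ 1/2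
  have hx8 : x ≤ 1 / 8 := by nlinarith
  refine ⟨?_, by linarith, by linarith⟩
  calc σ * δ₀ + 16 * a ^ 2 * σ * (1 + σ) ≤ (δ₀ + κ * α₁') + 16 * (2 * x ^ 2) := by linarith
    _ ≤ α₀ := by simp only [x] at *; linarith

/-- THE PLAQUETTE DEVIATION OVER THE WHOLE FAMILY OF DISCS, sharper form: an exterior whose plaquettes deviate by
`≤ δ₀ξ²` (`0 < ξ ≤ 1`) and whose axial potentials are `≤ a ≤ dev` with `δ₀ ≤ κ·dev`, under
`δ₀ + κα₁′ + 32(dev + α₁′)² ≤ α₀ ≤ 1/2`, has along every point `‖c‖ = ξσ`, `σ ≤ 1 + α₁′/dev` of the complexified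
segment plaquette deviation `≤ α₀ξ²`. [folklore] -/
theorem norm_hol_sub_one_le_of_condition' {𝕂 : Type*} [RCLike 𝕂] {𝔸 : Type*} [NormedRing 𝔸] [NormedAlgebra ℝ 𝔸]
    [NormedAlgebra 𝕂 𝔸] [CompleteSpace 𝔸] {c₁ : 𝕂} (c : 𝕂) (A₁ A₂ A₃ A₄ : 𝔸)
    {ξ σ a δ₀ κ α₀ α₁' dev : ℝ} (hξ0 : 0 < ξ) (hξ1 : ξ ≤ 1) (hα₀ : α₀ ≤ 1 / 2) (hdev : 0 < dev) (hα₁ : 0 ≤ α₁')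
    (hκ : 0 ≤ κ) (hδ₀0 : 0 ≤ δ₀) (hδ₀ : δ₀ ≤ κ * dev) (hsum : δ₀ + κ * α₁' + 32 * (dev + α₁') ^ 2 ≤ α₀)
    (hσ0 : 0 ≤ σ) (hσ : σ ≤ 1 + α₁' / dev) (hc₁ : ‖c₁‖ = ξ) (hc : ‖c‖ = ξ * σ) (ha0 : 0 ≤ a) (ha : a ≤ dev)
    (h₁ : ‖A₁‖ ≤ a) (h₂ : ‖A₂‖ ≤ a) (h₃ : ‖A₃‖ ≤ a) (h₄ : ‖A₄‖ ≤ a)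
    (hcurv : ‖exp (c₁ • A₁) * exp (c₁ • A₂) * exp (-(c₁ • A₃)) * exp (-(c₁ • A₄)) - 1‖ ≤ δ₀ * ξ ^ 2) :
    ‖exp (c • A₁) * exp (c • A₂) * exp (-(c • A₃)) * exp (-(c • A₄)) - 1‖ ≤ α₀ * ξ ^ 2 := by
  obtain ⟨hcoef, h4σ, h4⟩ := segment_condition_of_curvature hα₀ hdev hα₁ hκ hδ₀0 hδ₀ hsum hσ0 hσ ha0 ha
  have ha1 : 4 * ξ * a ≤ 1 := by nlinarith
  have hT : 4 * ξ * σ * a ≤ 1 := by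
    have h0 : 0 ≤ 4 * σ * a := by positivity
    nlinarith
  calc ‖exp (c • A₁) * exp (c • A₂) * exp (-(c • A₃)) * exp (-(c • A₄)) - 1‖
      ≤ ξ ^ 2 * (σ * δ₀ + 16 * a ^ 2 * σ * (1 + σ)) :=
        norm_hol_sub_one_le_of_curvature c A₁ A₂ A₃ A₄ hξ0 hσ0 hc₁ hc h₁ h₂ h₃ h₄ hcurv ha1 hT
    _ ≤ ξ ^ 2 * α₀ := mul_le_mul_of_nonneg_left hcoef (sq_nonneg ξ)
    _ = α₀ * ξ ^ 2 := mul_comm _ _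

/-- A BUDGET meeting the sharper condition: `δ₀ ≤ α₀/4`, `κα₁′ ≤ α₀/4` and `(dev + α₁′)² ≤ α₀/64` give
`δ₀ + κα₁′ + 32(dev + α₁′)² ≤ α₀`.  Reading (the cell's, constants only): the exterior must sit inside a quarter of the
curvature domain, the complex thickening is capped by `α₀/(4κ)` — void when `κ` (= 1/chain factor) is small — and the
potential bound plus thickening by `√α₀/8`; the thickening that may enter `lip = 4B/α₁′` of
`T4AxialChain.meanLipschitz_of_segment` is therefore `α₁′ = α₁` as soon as `α₁ ≤ min(α₀/(4κ), √α₀/8 − dev)`.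
[folklore] -/
theorem curvature_budget {α₀ α₁' dev δ₀ κ : ℝ} (h1 : δ₀ ≤ α₀ / 4) (h2 : κ * α₁' ≤ α₀ / 4)
    (h3 : (dev + α₁') ^ 2 ≤ α₀ / 64) : δ₀ + κ * α₁' + 32 * (dev + α₁') ^ 2 ≤ α₀ := by
  linarith

end Condition

end Literature.MathematicalPhysics.QuantumFieldTheory.Balaban1983to89.T4SegmentCurvature
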